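import Summits.AtomisticToContinuum.BoseEinsteinCondensation.Theses.BECDistantTilts
import HarnessLib.Audit

/-!
# Crux `BulkIndistinguishability` (stmt-AtomisticToContinuum-12178) — birth skeleton (BC3), line `birth`

Route `BECDistantTilts` (rank-3 crux).  With the crux's own data — Dirichlet ground state `Φ` of the box
of side `L = (N/ρ)^{1/3}`, periodic ground state `Θ` of the torus of the same side, one-particle density
`ρ_Φ` (mass `N = n+1`), wall-tilted environment law `m_Φ(Y) = ∫|Φ(z,Y)|²dz`, periodic insertion
(Papangelou) weight `λ(x;Y) = 1_cell|Θ(x,Y)|²/∫1_cell|Θ(z,Y)|²dz`, tilted laws `π_x = λ_x m_Φ/Z_Φ(x)` with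
`Z_Φ(x) = ∫λ(x;W)m_Φ(W)dW = E_{m_Φ}[λ_x]`, and torus Palm affinity `b(x,y) = L³∫√(1_cell|Θ(x,Y)|²·1_cell|Θ(y,Y)|²)dY` —
the crux asks `∫∫ρ_Φ(x)ρ_Φ(y)[b(x,y) − BC(π_x,π_y)]₊ ≤ ηN²`, `BC(π_x,π_y) = ∫√(π_xπ_y)`.

KEY IDENTITY (route review, refuter-rreview-0815T18-21-0): `BC(π_x,π_y) = A_Φ(x,y)/√(Z_Φ(x)Z_Φ(y))` with the
UNNORMALISED pair affinity `A_Φ(x,y) = ∫√(λ(x;Y)λ(y;Y)) m_Φ(Y)dY = E_{m_Φ}[√(λ_xλ_y)]`, while on the torus side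
`E_{m_Θ}[√(λ_xλ_y)] = b(x,y)/L³` and `E_{m_Θ}[λ_x] = 1/L³` (uniform torus density).  So the crux is the
statement that the functional `m ↦ E_m[√(λ_xλ_y)]/√(E_m[λ_x]E_m[λ_y])` does not drop when the torus
environment law `m_Θ` is replaced by the wall-tilted law `m_Φ`, for `ρ_Φ⊗ρ_Φ`-most pairs.  The line cuts it
along NUMERATOR (a two-point, PAIR observable) versus NORMALISER (a ONE-POINT observable), each a ONE-SIDED
insensitivity of the wall-tilted environment law to a distant local tilt, plus a deterministic affinity-ratio
inequality — three registered stubs (literal `let`-free signatures, fully qualified, so a `Theorems/` file can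
restate them verbatim with no `open`):

* `stub_pairAffinityTransfer` (TWO-POINT, load-bearing) — same quantifier prefix as the crux:
  `∫∫ρ_Φ(x)ρ_Φ(y)·[b(x,y) − L³·A_Φ(x,y)]₊ dxdy ≤ ηN²`, i.e. `L³E_{m_Φ}[√(λ_xλ_y)] ≥ L³E_{m_Θ}[√(λ_xλ_y)] − err`:
  the mean of the local pair observable `√(λ_xλ_y)` under the Dirichlet environment dominates its torus mean
  (bulk local indistinguishability of the two ground-state environment processes, two-point version; this is
  where "decorrelation of distant insertions under `m_Φ`" of the route header would enter).  Exact at `v = 0`.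
* `stub_onePointInsertionBound` (ONE-POINT) — same prefix: `∫ρ_Φ(x)·[L³Z_Φ(x) − 1]₊ dx ≤ ηN`, i.e.
  `E_{m_Φ}[λ_x] ≤ (1+err)·E_{m_Θ}[λ_x]`: the mean periodic-insertion intensity at a bulk point is not raised by
  the wall tilt (header item (i), one-point indistinguishability, in the one-sided direction the ratio needs;
  `∫Z_Φ(x)dx ≤ 1` always, so this is bulk UNIFORMITY in `L¹` of the insertion density `x ↦ E_{m_Φ}[λ_x]`).  Exact at `v = 0`.
* `stub_affinityRatioAlgebra` (deterministic, per instance, no ground-state hypotheses) — for measurable `Φ, Θ`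
  with `∫|Φ|² = 1` and `ε₁, ε₂ ≥ 0`: the pair inequality (error `ε₁`) and the one-point inequality (error `ε₂`)
  imply the crux inequality with error `ε₁ + ε₂`.  Proof by hand (all `ℝ≥0∞` corners checked): pointwise in
  `(x,y)`, with `e_x = [L³Z_Φ(x) − 1]₊` and `s = √((1+e_x)(1+e_y))`: if `0 < Z_Φ(x), Z_Φ(y) < ∞` then
  `BC = L³A_Φ/√(L³Z_Φ(x)·L³Z_Φ(y)) ≥ L³A_Φ/s` and `L³A_Φ ≤ √(L³Z_Φ(x)L³Z_Φ(y)) ≤ s` (Cauchy–Schwarz in `L²(m_Φ)`), so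
  `[b − BC]₊ ≤ [b − L³A_Φ]₊ + L³A_Φ(1 − 1/s) ≤ [b − L³A_Φ]₊ + (s − 1) ≤ [b − L³A_Φ]₊ + (e_x + e_y)/2` (AM–GM);
  if `Z_Φ(x) = 0` then `A_Φ(x,·) = 0` and the bound is `[b − 0]₊ ≤ [b − 0]₊`; if `Z_Φ(x) = ∞` then `e_x = ∞`
  (or `L ≤ 0`, `b ≡ 0`).  Integrate against `ρ_Φ⊗ρ_Φ` (mass `N²`, from `∫|Φ|² = 1` and Fubini through
  `MeasurableEquiv.piFinSuccAbove`): `≤ ε₁N² + N·ε₂N`.  Size M (ENNReal `rpow`/`div` bookkeeping + measurability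
  of the iterated lintegrals for `lintegral_add_left`).

`BulkIndistinguishability_of` is the sorry-free composition, hypotheses BY NAME (the `Goal.stub_*` statement
abbrevs, whose bodies are the stub signatures verbatim — `BulkIndistinguishability_of_stubs` type-checks that):
`ρ₀ = min ρ₀ᵖᵃⁱʳ ρ₀ᵒⁿᵉ`, errors `η/2 + η/2`, intersect the two eventual-`n` sets, feed both inequalities and the
conjuncts `Measurable Φ`, `Measurable Θ`, `∫|Φ|² = 1` of the ground-state predicates into the algebra stub.
Disproof used: none on file for this crux (`ledger crux ls stmt-AtomisticToContinuum-12178`: no workfiles, 2026-08-17).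
Negatives index (2026-08-17, 20 entries): only `BECSwapAffinity.SwapJensen` (stmt-3980, a real constant quantified
without its sign condition) is in this Palm family; here every real error carries `0 ≤ ε` / `0 < η` and every
`ℝ≥0∞` difference is a truncated subtraction read as a positive part.
BC3 probes (planner folder `bc/BulkIndistinguishability_probes*.lean`): for each stub `X`,
`X → BulkIndistinguishability` and `X → BoseEinsteinCondensation` by `first | exact? | simpa | aesop` FAIL (6/6).
-/

namespace Summit.AtomisticToContinuum.BoseEinsteinCondensation.Cruxes.BulkIndistinguishability.Birth

open MeasureTheory Filter
open scoped ENNReal NNReal BigOperators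

/-! ### Statements of the stubs BY NAME (audit names; bodies = the stub signatures verbatim) -/

namespace Goal

/-- Statement of `stub_pairAffinityTransfer` (two-point: `∫∫ρ_Φρ_Φ[b − L³A_Φ]₊ ≤ ηN²`). -/
abbrev stub_pairAffinityTransfer : Prop :=
  ∀ v : ℝ → ENNReal, Literature.MathematicalPhysics.QuantumManyBody.BoseGas.IsRepulsiveFiniteRange v → ∃ ρ₀ : ℝ, 0 < ρ₀ ∧ ∀ ρ : ℝ, 0 < ρ → ρ < ρ₀ → ∀ η : ℝ, 0 < η → ∀ᶠ n : ℕ in Filter.atTop, ∀ L : ℝ, L = Literature.MathematicalPhysics.QuantumManyBody.BoseGas.sideLength ρ (n + 1) → ∀ Φ : Literature.MathematicalPhysics.QuantumManyBody.BoseGas.Config (n + 1) → ℂ, (Measurable Φ ∧ (∀ X, X ∉ Literature.MathematicalPhysics.QuantumManyBody.BoseGas.boxN (n + 1) L → Φ X = 0) ∧ (∫⁻ X, (‖Φ X‖₊ : ENNReal) ^ 2) = 1 ∧ Literature.MathematicalPhysics.QuantumManyBody.BoseGas.groundStateEnergy v (n + 1) L ≠ ⊤ ∧ ∃ Ψ :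 ℕ → Literature.MathematicalPhysics.QuantumManyBody.BoseGas.TrialState (n + 1) L, Filter.Tendsto (fun k => Literature.MathematicalPhysics.QuantumManyBody.BoseGas.energy v (Ψ k)) Filter.atTop (nhds (Literature.MathematicalPhysics.QuantumManyBody.BoseGas.groundStateEnergy v (n + 1) L)) ∧ Filter.Tendsto (fun k => ∫⁻ X, (‖(Ψ k).ψ X - Φ X‖₊ : ENNReal) ^ 2) Filter.atTop (nhds 0)) → ∀ Θ : Literature.MathematicalPhysics.QuantumManyBody.BoseGas.Config (n + 1) → ℂ, (Measurable Θ ∧ (∫⁻ X in Literature.MathematicalPhysics.QuantumManyBody.BoseGas.cellN (n + 1) L, (‖Θ X‖₊ : ENNReal) ^ 2) = 1 ∧ Literature.MathematicalPhysics.QuantumManyBody.BoseGas.periodicGroundStateEnergy v (n + 1) L ≠ ⊤ ∧ ∃ Ψ : ℕ → Literature.MathematicalPhysics.QuantumManyBody.BoseGas.PeriodicTrialState (n + 1) L, Filter.Tendsto (fun k => Literature.MathematicalPhysics.QuantumManyBody.BoseGas.periodicEnergy v (Ψ k)) Filter.atTop (nhds (Literature.MathematicalPhysics.QuantumManyBody.BoseGas.periodicGroundStateEnergy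 v (n + 1) L)) ∧ Filter.Tendsto (fun k => ∫⁻ X in Literature.MathematicalPhysics.QuantumManyBody.BoseGas.cellN (n + 1) L, (‖(Ψ k).ψ X - Θ X‖₊ : ENNReal) ^ 2) Filter.atTop (nhds 0)) → ∀ ρΦ : Literature.MathematicalPhysics.QuantumManyBody.BoseGas.Space → ENNReal, ρΦ = (fun x => ((n : ENNReal) + 1) * ∫⁻ Y : Literature.MathematicalPhysics.QuantumManyBody.BoseGas.Config n, (‖Φ (Matrix.vecCons x Y)‖₊ : ENNReal) ^ 2) → ∀ mΦ : Literature.MathematicalPhysics.QuantumManyBody.BoseGas.Config n → ENNReal, mΦ = (fun Y => ∫⁻ z : Literature.MathematicalPhysics.QuantumManyBody.BoseGas.Space, (‖Φ (Matrix.vecCons z Y)‖₊ : ENNReal) ^ 2) → ∀ lam : Literature.MathematicalPhysics.QuantumManyBody.BoseGas.Space → Literature.MathematicalPhysics.QuantumManyBody.BoseGas.Config n → ENNReal, lam = (fun x Y => ((Literature.MathematicalPhysics.QuantumManyBody.BoseGas.cellN (n + 1) L).indicator (fun X => (‖Θ X‖₊ : ENNReal) ^ 2) (Matrix.vecCons x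 Y)) / ∫⁻ z : Literature.MathematicalPhysics.QuantumManyBody.BoseGas.Space, ((Literature.MathematicalPhysics.QuantumManyBody.BoseGas.cellN (n + 1) L).indicator (fun X => (‖Θ X‖₊ : ENNReal) ^ 2) (Matrix.vecCons z Y))) → ∀ b : Literature.MathematicalPhysics.QuantumManyBody.BoseGas.Space → Literature.MathematicalPhysics.QuantumManyBody.BoseGas.Space → ENNReal, b = (fun x y => ENNReal.ofReal (L ^ 3) * ∫⁻ Y : Literature.MathematicalPhysics.QuantumManyBody.BoseGas.Config n, (((Literature.MathematicalPhysics.QuantumManyBody.BoseGas.cellN (n + 1) L).indicator (fun X => (‖Θ X‖₊ : ENNReal) ^ 2) (Matrix.vecCons x Y)) * ((Literature.MathematicalPhysics.QuantumManyBody.BoseGas.cellN (n + 1) L).indicator (fun X => (‖Θ X‖₊ : ENNReal) ^ 2) (Matrix.vecCons y Y))) ^ ((1 : ℝ) / 2)) → ∫⁻ x : Literature.MathematicalPhysics.QuantumManyBody.BoseGas.Space, ∫⁻ y : Literature.MathematicalPhysics.QuantumManyBody.BoseGas.Space, ρΦ x * ρΦ y * (b x y - ENNReal.ofReal (L ^ 3)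 * ∫⁻ Y : Literature.MathematicalPhysics.QuantumManyBody.BoseGas.Config n, (lam x Y * lam y Y) ^ ((1 : ℝ) / 2) * mΦ Y) ≤ ENNReal.ofReal η * ((n : ENNReal) + 1) ^ 2

/-- Statement of `stub_onePointInsertionBound` (one-point: `∫ρ_Φ[L³Z_Φ − 1]₊ ≤ ηN`). -/
abbrev stub_onePointInsertionBound : Prop :=
  ∀ v : ℝ → ENNReal, Literature.MathematicalPhysics.QuantumManyBody.BoseGas.IsRepulsiveFiniteRange v → ∃ ρ₀ : ℝ, 0 < ρ₀ ∧ ∀ ρ : ℝ, 0 < ρ → ρ < ρ₀ → ∀ η : ℝ, 0 < η → ∀ᶠ n : ℕ in Filter.atTop, ∀ L : ℝ, L = Literature.MathematicalPhysics.QuantumManyBody.BoseGas.sideLength ρ (n + 1) → ∀ Φ : Literature.MathematicalPhysics.QuantumManyBody.BoseGas.Config (n + 1) → ℂ, (Measurable Φ ∧ (∀ X, X ∉ Literature.MathematicalPhysics.QuantumManyBody.BoseGas.boxN (n + 1) L → Φ X = 0) ∧ (∫⁻ X, (‖Φ X‖₊ : ENNReal) ^ 2) = 1 ∧ Literature.MathematicalPhysics.QuantumManyBody.BoseGas.groundStateEnergy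 v (n + 1) L ≠ ⊤ ∧ ∃ Ψ : ℕ → Literature.MathematicalPhysics.QuantumManyBody.BoseGas.TrialState (n + 1) L, Filter.Tendsto (fun k => Literature.MathematicalPhysics.QuantumManyBody.BoseGas.energy v (Ψ k)) Filter.atTop (nhds (Literature.MathematicalPhysics.QuantumManyBody.BoseGas.groundStateEnergy v (n + 1) L)) ∧ Filter.Tendsto (fun k => ∫⁻ X, (‖(Ψ k).ψ X - Φ X‖₊ : ENNReal) ^ 2) Filter.atTop (nhds 0)) → ∀ Θ : Literature.MathematicalPhysics.QuantumManyBody.BoseGas.Config (n + 1) → ℂ, (Measurable Θ ∧ (∫⁻ X in Literature.MathematicalPhysics.QuantumManyBody.BoseGas.cellN (n + 1) L, (‖Θ X‖₊ : ENNReal) ^ 2) = 1 ∧ Literature.MathematicalPhysics.QuantumManyBody.BoseGas.periodicGroundStateEnergy v (n + 1) L ≠ ⊤ ∧ ∃ Ψ : ℕ → Literature.MathematicalPhysics.QuantumManyBody.BoseGas.PeriodicTrialState (n + 1) L, Filter.Tendsto (fun k => Literature.MathematicalPhysics.QuantumManyBody.BoseGas.periodicEnergy v (Ψ k)) Filter.atTop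 (nhds (Literature.MathematicalPhysics.QuantumManyBody.BoseGas.periodicGroundStateEnergy v (n + 1) L)) ∧ Filter.Tendsto (fun k => ∫⁻ X in Literature.MathematicalPhysics.QuantumManyBody.BoseGas.cellN (n + 1) L, (‖(Ψ k).ψ X - Θ X‖₊ : ENNReal) ^ 2) Filter.atTop (nhds 0)) → ∀ ρΦ : Literature.MathematicalPhysics.QuantumManyBody.BoseGas.Space → ENNReal, ρΦ = (fun x => ((n : ENNReal) + 1) * ∫⁻ Y : Literature.MathematicalPhysics.QuantumManyBody.BoseGas.Config n, (‖Φ (Matrix.vecCons x Y)‖₊ : ENNReal) ^ 2) → ∀ mΦ : Literature.MathematicalPhysics.QuantumManyBody.BoseGas.Config n → ENNReal, mΦ = (fun Y => ∫⁻ z : Literature.MathematicalPhysics.QuantumManyBody.BoseGas.Space, (‖Φ (Matrix.vecCons z Y)‖₊ : ENNReal) ^ 2) → ∀ lam : Literature.MathematicalPhysics.QuantumManyBody.BoseGas.Space → Literature.MathematicalPhysics.QuantumManyBody.BoseGas.Config n → ENNReal, lam = (fun x Y => ((Literature.MathematicalPhysics.QuantumManyBody.BoseGas.cellN (n + 1)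 L).indicator (fun X => (‖Θ X‖₊ : ENNReal) ^ 2) (Matrix.vecCons x Y)) / ∫⁻ z : Literature.MathematicalPhysics.QuantumManyBody.BoseGas.Space, ((Literature.MathematicalPhysics.QuantumManyBody.BoseGas.cellN (n + 1) L).indicator (fun X => (‖Θ X‖₊ : ENNReal) ^ 2) (Matrix.vecCons z Y))) → ∫⁻ x : Literature.MathematicalPhysics.QuantumManyBody.BoseGas.Space, ρΦ x * (ENNReal.ofReal (L ^ 3) * (∫⁻ W : Literature.MathematicalPhysics.QuantumManyBody.BoseGas.Config n, lam x W * mΦ W) - 1) ≤ ENNReal.ofReal η * ((n : ENNReal) + 1)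

/-- Statement of `stub_affinityRatioAlgebra` (per-instance affinity-ratio inequality). -/
abbrev stub_affinityRatioAlgebra : Prop :=
  ∀ (n : ℕ) (L ε₁ ε₂ : ℝ) (Φ Θ : Literature.MathematicalPhysics.QuantumManyBody.BoseGas.Config (n + 1) → ℂ), 0 ≤ ε₁ → 0 ≤ ε₂ → Measurable Φ → Measurable Θ → (∫⁻ X, (‖Φ X‖₊ : ENNReal) ^ 2) = 1 → ∀ ρΦ : Literature.MathematicalPhysics.QuantumManyBody.BoseGas.Space → ENNReal, ρΦ = (fun x => ((n : ENNReal) + 1) * ∫⁻ Y : Literature.MathematicalPhysics.QuantumManyBody.BoseGas.Config n, (‖Φ (Matrix.vecCons x Y)‖₊ : ENNReal) ^ 2) → ∀ mΦ : Literature.MathematicalPhysics.QuantumManyBody.BoseGas.Config n → ENNReal, mΦ = (fun Y => ∫⁻ z : Literature.MathematicalPhysics.QuantumManyBody.BoseGas.Space, (‖Φ (Matrix.vecCons z Y)‖₊ : ENNReal) ^ 2) → ∀ lam : Literature.MathematicalPhysics.QuantumManyBody.BoseGas.Space → Literature.MathematicalPhysics.QuantumManyBody.BoseGas.Config n → ENNReal,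 lam = (fun x Y => ((Literature.MathematicalPhysics.QuantumManyBody.BoseGas.cellN (n + 1) L).indicator (fun X => (‖Θ X‖₊ : ENNReal) ^ 2) (Matrix.vecCons x Y)) / ∫⁻ z : Literature.MathematicalPhysics.QuantumManyBody.BoseGas.Space, ((Literature.MathematicalPhysics.QuantumManyBody.BoseGas.cellN (n + 1) L).indicator (fun X => (‖Θ X‖₊ : ENNReal) ^ 2) (Matrix.vecCons z Y))) → ∀ π : Literature.MathematicalPhysics.QuantumManyBody.BoseGas.Space → Literature.MathematicalPhysics.QuantumManyBody.BoseGas.Config n → ENNReal, π = (fun x Y => lam x Y * mΦ Y / ∫⁻ W : Literature.MathematicalPhysics.QuantumManyBody.BoseGas.Config n, lam x W * mΦ W) → ∀ b : Literature.MathematicalPhysics.QuantumManyBody.BoseGas.Space → Literature.MathematicalPhysics.QuantumManyBody.BoseGas.Space → ENNReal, b = (fun x y => ENNReal.ofReal (L ^ 3) * ∫⁻ Y : Literature.MathematicalPhysics.QuantumManyBody.BoseGas.Config n, (((Literature.MathematicalPhysics.QuantumManyBody.BoseGas.cellN (n + 1) L).indicator (fun X => (‖Θ X‖₊ : ENNReal)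 ^ 2) (Matrix.vecCons x Y)) * ((Literature.MathematicalPhysics.QuantumManyBody.BoseGas.cellN (n + 1) L).indicator (fun X => (‖Θ X‖₊ : ENNReal) ^ 2) (Matrix.vecCons y Y))) ^ ((1 : ℝ) / 2)) → (∫⁻ x : Literature.MathematicalPhysics.QuantumManyBody.BoseGas.Space, ∫⁻ y : Literature.MathematicalPhysics.QuantumManyBody.BoseGas.Space, ρΦ x * ρΦ y * (b x y - ENNReal.ofReal (L ^ 3) * ∫⁻ Y : Literature.MathematicalPhysics.QuantumManyBody.BoseGas.Config n, (lam x Y * lam y Y) ^ ((1 : ℝ) / 2) * mΦ Y) ≤ ENNReal.ofReal ε₁ * ((n : ENNReal) + 1) ^ 2) → (∫⁻ x : Literature.MathematicalPhysics.QuantumManyBody.BoseGas.Space, ρΦ x * (ENNReal.ofReal (L ^ 3) * (∫⁻ W : Literature.MathematicalPhysics.QuantumManyBody.BoseGas.Config n, lam x W * mΦ W) - 1) ≤ ENNReal.ofReal ε₂ * ((n : ENNReal) + 1)) → ∫⁻ x : Literature.MathematicalPhysics.QuantumManyBody.BoseGas.Space, ∫⁻ y : Literature.MathematicalPhysics.QuantumManyBody.BoseGas.Space,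 ρΦ x * ρΦ y * (b x y - ∫⁻ Y : Literature.MathematicalPhysics.QuantumManyBody.BoseGas.Config n, (π x Y * π y Y) ^ ((1 : ℝ) / 2)) ≤ ENNReal.ofReal (ε₁ + ε₂) * ((n : ENNReal) + 1) ^ 2

end Goal

/-! ### Registered stubs (the only `sorry`s of this file) -/

/-- **Stub 1 (two-point; PAIR-AFFINITY TRANSFER, load-bearing).** For every repulsive finite-range `v`
there is `ρ₀ > 0` such that for `0 < ρ < ρ₀` and every `η > 0`, for all large `N = n+1`, for every Dirichlet
ground state `Φ` of the box of side `L = (N/ρ)^{1/3}` and every periodic ground state `Θ` of the torus of the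
same side, with `ρ_Φ, m_Φ, λ` as in the crux and `A_Φ(x,y) = ∫√(λ(x;Y)λ(y;Y))m_Φ(Y)dY`:
`∫∫ρ_Φ(x)ρ_Φ(y)[b(x,y) − L³A_Φ(x,y)]₊ dxdy ≤ ηN²` — the unnormalised pair-insertion affinity under the
wall-tilted environment law dominates the torus Palm affinity (`= L³E_{m_Θ}[√(λ_xλ_y)]`) in
`ρ_Φ⊗ρ_Φ`-weighted mean.  Exact (`LHS = 0`) at `v = 0`. -/
theorem stub_pairAffinityTransfer : ∀ v : ℝ → ENNReal, Literature.MathematicalPhysics.QuantumManyBody.BoseGas.IsRepulsiveFiniteRange v → ∃ ρ₀ : ℝ, 0 < ρ₀ ∧ ∀ ρ : ℝ, 0 < ρ → ρ < ρ₀ → ∀ η : ℝ, 0 < η → ∀ᶠ n : ℕ in Filter.atTop, ∀ L : ℝ, L = Literature.MathematicalPhysics.QuantumManyBody.BoseGas.sideLength ρ (n + 1) → ∀ Φ : Literature.MathematicalPhysics.QuantumManyBody.BoseGas.Config (n + 1) → ℂ, (Measurable Φ ∧ (∀ X, X ∉ Literature.MathematicalPhysics.QuantumManyBody.BoseGas.boxN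 (n + 1) L → Φ X = 0) ∧ (∫⁻ X, (‖Φ X‖₊ : ENNReal) ^ 2) = 1 ∧ Literature.MathematicalPhysics.QuantumManyBody.BoseGas.groundStateEnergy v (n + 1) L ≠ ⊤ ∧ ∃ Ψ : ℕ → Literature.MathematicalPhysics.QuantumManyBody.BoseGas.TrialState (n + 1) L, Filter.Tendsto (fun k => Literature.MathematicalPhysics.QuantumManyBody.BoseGas.energy v (Ψ k)) Filter.atTop (nhds (Literature.MathematicalPhysics.QuantumManyBody.BoseGas.groundStateEnergy v (n + 1) L)) ∧ Filter.Tendsto (fun k => ∫⁻ X, (‖(Ψ k).ψ X - Φ X‖₊ : ENNReal) ^ 2) Filter.atTop (nhds 0)) → ∀ Θ : Literature.MathematicalPhysics.QuantumManyBody.BoseGas.Config (n + 1) → ℂ, (Measurable Θ ∧ (∫⁻ X in Literature.MathematicalPhysics.QuantumManyBody.BoseGas.cellN (n + 1) L, (‖Θ X‖₊ : ENNReal) ^ 2) = 1 ∧ Literature.MathematicalPhysics.QuantumManyBody.BoseGas.periodicGroundStateEnergy v (n + 1) L ≠ ⊤ ∧ ∃ Ψ : ℕ → Literature.MathematicalPhysics.QuantumManyBody.BoseGas.PeriodicTrialState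 (n + 1) L, Filter.Tendsto (fun k => Literature.MathematicalPhysics.QuantumManyBody.BoseGas.periodicEnergy v (Ψ k)) Filter.atTop (nhds (Literature.MathematicalPhysics.QuantumManyBody.BoseGas.periodicGroundStateEnergy v (n + 1) L)) ∧ Filter.Tendsto (fun k => ∫⁻ X in Literature.MathematicalPhysics.QuantumManyBody.BoseGas.cellN (n + 1) L, (‖(Ψ k).ψ X - Θ X‖₊ : ENNReal) ^ 2) Filter.atTop (nhds 0)) → ∀ ρΦ : Literature.MathematicalPhysics.QuantumManyBody.BoseGas.Space → ENNReal, ρΦ = (fun x => ((n : ENNReal) + 1) * ∫⁻ Y : Literature.MathematicalPhysics.QuantumManyBody.BoseGas.Config n, (‖Φ (Matrix.vecCons x Y)‖₊ : ENNReal) ^ 2) → ∀ mΦ : Literature.MathematicalPhysics.QuantumManyBody.BoseGas.Config n → ENNReal, mΦ = (fun Y => ∫⁻ z : Literature.MathematicalPhysics.QuantumManyBody.BoseGas.Space, (‖Φ (Matrix.vecCons z Y)‖₊ : ENNReal) ^ 2) → ∀ lam : Literature.MathematicalPhysics.QuantumManyBody.BoseGas.Space → Literature.MathematicalPhysics.QuantumManyBody.BoseGas.Config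 n → ENNReal, lam = (fun x Y => ((Literature.MathematicalPhysics.QuantumManyBody.BoseGas.cellN (n + 1) L).indicator (fun X => (‖Θ X‖₊ : ENNReal) ^ 2) (Matrix.vecCons x Y)) / ∫⁻ z : Literature.MathematicalPhysics.QuantumManyBody.BoseGas.Space, ((Literature.MathematicalPhysics.QuantumManyBody.BoseGas.cellN (n + 1) L).indicator (fun X => (‖Θ X‖₊ : ENNReal) ^ 2) (Matrix.vecCons z Y))) → ∀ b : Literature.MathematicalPhysics.QuantumManyBody.BoseGas.Space → Literature.MathematicalPhysics.QuantumManyBody.BoseGas.Space → ENNReal, b = (fun x y => ENNReal.ofReal (L ^ 3) * ∫⁻ Y : Literature.MathematicalPhysics.QuantumManyBody.BoseGas.Config n, (((Literature.MathematicalPhysics.QuantumManyBody.BoseGas.cellN (n + 1) L).indicator (fun X => (‖Θ X‖₊ : ENNReal) ^ 2) (Matrix.vecCons x Y)) * ((Literature.MathematicalPhysics.QuantumManyBody.BoseGas.cellN (n + 1) L).indicator (fun X => (‖Θ X‖₊ : ENNReal) ^ 2) (Matrix.vecCons y Y))) ^ ((1 : ℝ) / 2)) → ∫⁻ x : Literature.MathematicalPhysics.QuantumManyBody.BoseGas.Space,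 ∫⁻ y : Literature.MathematicalPhysics.QuantumManyBody.BoseGas.Space, ρΦ x * ρΦ y * (b x y - ENNReal.ofReal (L ^ 3) * ∫⁻ Y : Literature.MathematicalPhysics.QuantumManyBody.BoseGas.Config n, (lam x Y * lam y Y) ^ ((1 : ℝ) / 2) * mΦ Y) ≤ ENNReal.ofReal η * ((n : ENNReal) + 1) ^ 2 := by
  sorry

/-- **Stub 2 (one-point; INSERTION-INTENSITY BOUND).** Same data: with `Z_Φ(x) = ∫λ(x;W)m_Φ(W)dW = E_{m_Φ}[λ_x]`
(the normaliser of `π_x`), `∫ρ_Φ(x)[L³Z_Φ(x) − 1]₊ dx ≤ ηN` — the mean periodic-insertion intensity at `x` under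
the wall-tilted environment law does not exceed its torus value `1/L³` except on a `ρ_Φ`-negligible set
(bulk `L¹`-uniformity of `x ↦ E_{m_Φ}[λ_x]`, whose total mass is `≤ 1`).  Exact at `v = 0`. -/
theorem stub_onePointInsertionBound : ∀ v : ℝ → ENNReal, Literature.MathematicalPhysics.QuantumManyBody.BoseGas.IsRepulsiveFiniteRange v → ∃ ρ₀ : ℝ, 0 < ρ₀ ∧ ∀ ρ : ℝ, 0 < ρ → ρ < ρ₀ → ∀ η : ℝ, 0 < η → ∀ᶠ n : ℕ in Filter.atTop, ∀ L : ℝ, L = Literature.MathematicalPhysics.QuantumManyBody.BoseGas.sideLength ρ (n + 1) → ∀ Φ : Literature.MathematicalPhysics.QuantumManyBody.BoseGas.Config (n + 1) → ℂ, (Measurable Φ ∧ (∀ X, X ∉ Literature.MathematicalPhysics.QuantumManyBody.BoseGas.boxN (n + 1) L → Φ X = 0) ∧ (∫⁻ X, (‖Φ X‖₊ : ENNReal) ^ 2) = 1 ∧ Literature.MathematicalPhysics.QuantumManyBody.BoseGas.groundStateEnergy v (n + 1) L ≠ ⊤ ∧ ∃ Ψ : ℕ → Literature.MathematicalPhysics.QuantumManyBody.BoseGas.TrialState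 (n + 1) L, Filter.Tendsto (fun k => Literature.MathematicalPhysics.QuantumManyBody.BoseGas.energy v (Ψ k)) Filter.atTop (nhds (Literature.MathematicalPhysics.QuantumManyBody.BoseGas.groundStateEnergy v (n + 1) L)) ∧ Filter.Tendsto (fun k => ∫⁻ X, (‖(Ψ k).ψ X - Φ X‖₊ : ENNReal) ^ 2) Filter.atTop (nhds 0)) → ∀ Θ : Literature.MathematicalPhysics.QuantumManyBody.BoseGas.Config (n + 1) → ℂ, (Measurable Θ ∧ (∫⁻ X in Literature.MathematicalPhysics.QuantumManyBody.BoseGas.cellN (n + 1) L, (‖Θ X‖₊ : ENNReal) ^ 2) = 1 ∧ Literature.MathematicalPhysics.QuantumManyBody.BoseGas.periodicGroundStateEnergy v (n + 1) L ≠ ⊤ ∧ ∃ Ψ : ℕ → Literature.MathematicalPhysics.QuantumManyBody.BoseGas.PeriodicTrialState (n + 1) L, Filter.Tendsto (fun k => Literature.MathematicalPhysics.QuantumManyBody.BoseGas.periodicEnergy v (Ψ k)) Filter.atTop (nhds (Literature.MathematicalPhysics.QuantumManyBody.BoseGas.periodicGroundStateEnergy v (n + 1) L)) ∧ Filter.Tendsto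 (fun k => ∫⁻ X in Literature.MathematicalPhysics.QuantumManyBody.BoseGas.cellN (n + 1) L, (‖(Ψ k).ψ X - Θ X‖₊ : ENNReal) ^ 2) Filter.atTop (nhds 0)) → ∀ ρΦ : Literature.MathematicalPhysics.QuantumManyBody.BoseGas.Space → ENNReal, ρΦ = (fun x => ((n : ENNReal) + 1) * ∫⁻ Y : Literature.MathematicalPhysics.QuantumManyBody.BoseGas.Config n, (‖Φ (Matrix.vecCons x Y)‖₊ : ENNReal) ^ 2) → ∀ mΦ : Literature.MathematicalPhysics.QuantumManyBody.BoseGas.Config n → ENNReal, mΦ = (fun Y => ∫⁻ z : Literature.MathematicalPhysics.QuantumManyBody.BoseGas.Space, (‖Φ (Matrix.vecCons z Y)‖₊ : ENNReal) ^ 2) → ∀ lam : Literature.MathematicalPhysics.QuantumManyBody.BoseGas.Space → Literature.MathematicalPhysics.QuantumManyBody.BoseGas.Config n → ENNReal, lam = (fun x Y => ((Literature.MathematicalPhysics.QuantumManyBody.BoseGas.cellN (n + 1) L).indicator (fun X => (‖Θ X‖₊ : ENNReal) ^ 2) (Matrix.vecCons x Y)) / ∫⁻ z : Literature.MathematicalPhysics.QuantumManyBody.BoseGas.Space,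 ((Literature.MathematicalPhysics.QuantumManyBody.BoseGas.cellN (n + 1) L).indicator (fun X => (‖Θ X‖₊ : ENNReal) ^ 2) (Matrix.vecCons z Y))) → ∫⁻ x : Literature.MathematicalPhysics.QuantumManyBody.BoseGas.Space, ρΦ x * (ENNReal.ofReal (L ^ 3) * (∫⁻ W : Literature.MathematicalPhysics.QuantumManyBody.BoseGas.Config n, lam x W * mΦ W) - 1) ≤ ENNReal.ofReal η * ((n : ENNReal) + 1) := by
  sorry

/-- **Stub 3 (deterministic AFFINITY-RATIO ALGEBRA, per instance).** For any `n, L`, `ε₁, ε₂ ≥ 0` and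
measurable `Φ, Θ : Config (n+1) → ℂ` with `∫|Φ|² = 1`, and `ρ_Φ, m_Φ, λ, π, b` as in the crux: the pair
inequality with error `ε₁` and the one-point inequality with error `ε₂` imply
`∫∫ρ_Φ(x)ρ_Φ(y)[b(x,y) − ∫√(π_xπ_y)]₊ ≤ (ε₁+ε₂)N²`.  Pointwise `[b − BC]₊ ≤ [b − L³A_Φ]₊ + (e_x+e_y)/2`
(`BC = L³A_Φ/√(L³Z_Φ(x)L³Z_Φ(y))`, Cauchy–Schwarz `L³A_Φ ≤ √(L³Z_Φ(x)L³Z_Φ(y))`, AM–GM; the corners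
`Z_Φ ∈ {0, ∞}`, `L ≤ 0` are trivial), then integrate against `ρ_Φ⊗ρ_Φ` of mass `N²`. -/
theorem stub_affinityRatioAlgebra : ∀ (n : ℕ) (L ε₁ ε₂ : ℝ) (Φ Θ : Literature.MathematicalPhysics.QuantumManyBody.BoseGas.Config (n + 1) → ℂ), 0 ≤ ε₁ → 0 ≤ ε₂ → Measurable Φ → Measurable Θ → (∫⁻ X, (‖Φ X‖₊ : ENNReal) ^ 2) = 1 → ∀ ρΦ : Literature.MathematicalPhysics.QuantumManyBody.BoseGas.Space → ENNReal, ρΦ = (fun x => ((n : ENNReal) + 1) * ∫⁻ Y : Literature.MathematicalPhysics.QuantumManyBody.BoseGas.Config n, (‖Φ (Matrix.vecCons x Y)‖₊ : ENNReal) ^ 2) → ∀ mΦ : Literature.MathematicalPhysics.QuantumManyBody.BoseGas.Config n → ENNReal, mΦ = (fun Y => ∫⁻ z : Literature.MathematicalPhysics.QuantumManyBody.BoseGas.Space, (‖Φ (Matrix.vecCons z Y)‖₊ : ENNReal) ^ 2) → ∀ lam : Literature.MathematicalPhysics.QuantumManyBody.BoseGas.Space → Literature.MathematicalPhysics.QuantumManyBody.BoseGas.Config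 n → ENNReal, lam = (fun x Y => ((Literature.MathematicalPhysics.QuantumManyBody.BoseGas.cellN (n + 1) L).indicator (fun X => (‖Θ X‖₊ : ENNReal) ^ 2) (Matrix.vecCons x Y)) / ∫⁻ z : Literature.MathematicalPhysics.QuantumManyBody.BoseGas.Space, ((Literature.MathematicalPhysics.QuantumManyBody.BoseGas.cellN (n + 1) L).indicator (fun X => (‖Θ X‖₊ : ENNReal) ^ 2) (Matrix.vecCons z Y))) → ∀ π : Literature.MathematicalPhysics.QuantumManyBody.BoseGas.Space → Literature.MathematicalPhysics.QuantumManyBody.BoseGas.Config n → ENNReal, π = (fun x Y => lam x Y * mΦ Y / ∫⁻ W : Literature.MathematicalPhysics.QuantumManyBody.BoseGas.Config n, lam x W * mΦ W) → ∀ b : Literature.MathematicalPhysics.QuantumManyBody.BoseGas.Space → Literature.MathematicalPhysics.QuantumManyBody.BoseGas.Space → ENNReal, b = (fun x y => ENNReal.ofReal (L ^ 3) * ∫⁻ Y : Literature.MathematicalPhysics.QuantumManyBody.BoseGas.Config n, (((Literature.MathematicalPhysics.QuantumManyBody.BoseGas.cellN (n + 1) L).indicator (fun X => (‖Θ X‖₊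 : ENNReal) ^ 2) (Matrix.vecCons x Y)) * ((Literature.MathematicalPhysics.QuantumManyBody.BoseGas.cellN (n + 1) L).indicator (fun X => (‖Θ X‖₊ : ENNReal) ^ 2) (Matrix.vecCons y Y))) ^ ((1 : ℝ) / 2)) → (∫⁻ x : Literature.MathematicalPhysics.QuantumManyBody.BoseGas.Space, ∫⁻ y : Literature.MathematicalPhysics.QuantumManyBody.BoseGas.Space, ρΦ x * ρΦ y * (b x y - ENNReal.ofReal (L ^ 3) * ∫⁻ Y : Literature.MathematicalPhysics.QuantumManyBody.BoseGas.Config n, (lam x Y * lam y Y) ^ ((1 : ℝ) / 2) * mΦ Y) ≤ ENNReal.ofReal ε₁ * ((n : ENNReal) + 1) ^ 2) → (∫⁻ x : Literature.MathematicalPhysics.QuantumManyBody.BoseGas.Space, ρΦ x * (ENNReal.ofReal (L ^ 3) * (∫⁻ W : Literature.MathematicalPhysics.QuantumManyBody.BoseGas.Config n, lam x W * mΦ W) - 1) ≤ ENNReal.ofReal ε₂ * ((n : ENNReal) + 1)) → ∫⁻ x : Literature.MathematicalPhysics.QuantumManyBody.BoseGas.Space, ∫⁻ y : Literature.MathematicalPhysics.QuantumManyBody.BoseGas.Space,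 ρΦ x * ρΦ y * (b x y - ∫⁻ Y : Literature.MathematicalPhysics.QuantumManyBody.BoseGas.Config n, (π x Y * π y Y) ^ ((1 : ℝ) / 2)) ≤ ENNReal.ofReal (ε₁ + ε₂) * ((n : ENNReal) + 1) ^ 2 := by
  sorry

/-! ### Composition (no `sorry` below this line) -/

/-- **The three stubs imply the crux `BulkIndistinguishability` BY NAME** (hypotheses by name: the statement
abbrevs `Goal.stub_pairAffinityTransfer`, `Goal.stub_onePointInsertionBound`, `Goal.stub_affinityRatioAlgebra`).
`ρ₀ = min ρ₀ᵖᵃⁱʳ ρ₀ᵒⁿᵉ`; for `η > 0` run both analytic stubs with `η/2`, intersect the eventual-`n` sets, and feed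
the two inequalities together with `Measurable Φ`, `Measurable Θ`, `∫|Φ|² = 1` (conjuncts of the ground-state
predicates) into the algebra stub; `η/2 + η/2 = η`. [folklore] -/
theorem BulkIndistinguishability_of :
    Goal.stub_pairAffinityTransfer → Goal.stub_onePointInsertionBound → Goal.stub_affinityRatioAlgebra →
    Summit.AtomisticToContinuum.BoseEinsteinCondensation.Theses.BECDistantTilts.BulkIndistinguishability := by
  intro hPair hOne hAlg v hv
  obtain ⟨ρ₁, hρ₁, H₁⟩ := hPair v hv
  obtain ⟨ρ₂, hρ₂, H₂⟩ := hOne v hv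
  refine ⟨min ρ₁ ρ₂, lt_min hρ₁ hρ₂, fun ρ hρ hρlt η hη => ?_⟩
  have hρ1 : ρ < ρ₁ := lt_of_lt_of_le hρlt (min_le_left _ _)
  have hρ2 : ρ < ρ₂ := lt_of_lt_of_le hρlt (min_le_right _ _)
  have hη2 : (0 : ℝ) < η / 2 := half_pos hη
  filter_upwards [H₁ ρ hρ hρ1 (η / 2) hη2, H₂ ρ hρ hρ2 (η / 2) hη2] with n hn₁ hn₂
  intro L hL Φ hΦ Θ hΘ ρΦ hρΦ mΦ hmΦ lam hlam π hπ b hb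
  have i₁ := hn₁ L hL Φ hΦ Θ hΘ ρΦ hρΦ mΦ hmΦ lam hlam b hb
  have i₂ := hn₂ L hL Φ hΦ Θ hΘ ρΦ hρΦ mΦ hmΦ lam hlam
  have key := hAlg n L (η / 2) (η / 2) Φ Θ hη2.le hη2.le hΦ.1 hΘ.1 hΦ.2.2.1 ρΦ hρΦ mΦ hmΦ lam hlam
    π hπ b hb i₁ i₂
  rwa [add_halves] at key

/-- The skeleton as a proof of the crux THROUGH the sorried stubs (it also type-checks that the stub
signatures are the `Goal` statements verbatim).  Becomes a proof of stmt-AtomisticToContinuum-12178 once the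
three stubs land sorry-free. [folklore] -/
theorem BulkIndistinguishability_of_stubs : Summit.AtomisticToContinuum.BoseEinsteinCondensation.Theses.BECDistantTilts.BulkIndistinguishability :=
  BulkIndistinguishability_of stub_pairAffinityTransfer stub_onePointInsertionBound stub_affinityRatioAlgebra

end Summit.AtomisticToContinuum.BoseEinsteinCondensation.Cruxes.BulkIndistinguishability.Birth
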